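import Mathlib
import HarnessLib
import Summits.NavierStokesRegularity.NavierStokesRegularity.Theorems.QuarterLogPincerColdSmoothingDefs
import Summits.NavierStokesRegularity.NavierStokesRegularity.Theorems.QuarterLogPincerTypeIQuantSubcubicExpStubUniformScaledEnergy
import Summits.NavierStokesRegularity.NavierStokesRegularity.Theorems.QuarterLogPincerTypeIQuantSubcubicExpFrameTools

/-!
# Route `QuarterLogPincer`, crux `TypeIQuantSubcubicExp` (stmt-NavierStokesRegularity-24077), line `cold_smoothing` —
# CS1 `stub_coldCube : ColdCube` BY NAME (cold cylinders have small scaled cubic quantity)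

ns-idea-7's line `Cruxes/TypeIQuantSubcubicExp/Lines/cold_smoothing.lean` (v1.1, idea-crit-4 PASS) carries the plumbing stub CS1
`stub_coldCube : ColdCube` («size S–M; Hölder + the PROVED I1»): for `M ≥ 1` there is `C₁ = C₁(M) > 0` such that in the frame with
rate `M`, an `ε`-cold backward cylinder `Q_ρ(z)` with `ρ² ≤ z₁ ≤ T` has `cknC ρ z u ≤ C₁ ε`.  Proof, exactly as the card says, over the
landed objects (`…ColdSmoothingDefs`): restrict the frame to `[0, z₁]` (`ThinCascade.frame_restrict`, `typeI_restrict`) and read the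
A-clause of I1 `ThinCascade.stub_uniformScaledEnergy` at vertex `z₁`, radius `ρ`, centre `z₂` — slice energy `∫_{B_ρ(z₂)}‖u(t)‖² ≤ Cρ` for
`t ∈ [z₁ − ρ², z₁]`; coldness gives `‖u(t,y)‖ ≤ ε (T+τ−t)^{-1/2}` on the cylinder, so `‖u‖³ ≤ ε(T+τ−t)^{-1/2}‖u‖²`; Tonelli (the inequality
`lintegral_prod_le`, no measurability needed) and `∫_{z₁−ρ²}^{z₁}(T+τ−t)^{-1/2}dt = 2(√(a+ρ²) − √a) ≤ 2ρ` (`a = T+τ−z₁ ≥ 0`) give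
`∫∫_{Q_ρ(z)}‖u‖³ ≤ 2 max(C,0) ε ρ²`, i.e. `cknC ρ z u ≤ 2 max(C,0) ε`; `C₁ := 2 max(C,0) + 1`.

HONEST FRAME: Hölder bookkeeping for HYPOTHETICAL Type-I classical solutions over the tree theorem I1; it closes one registered plumbing
stub of a line four levels below the crux; nothing here bears on 24077's truth, W7 or Navier–Stokes regularity (OPEN / not proved).
pub-ns-dss typer (g38), `--supports stmt-NavierStokesRegularity-24077`.
-/

noncomputable section

set_option linter.dupNamespace false

namespace Summit.NavierStokesRegularity.NavierStokesRegularity.Cruxes.TypeIQuantSubcubicExp.ColdSmoothing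

open MeasureTheory Set Function Filter Topology Metric
open scoped ENNReal NNReal
open Literature.Analysis Literature.Analysis.FluidPDE
open Summit.NavierStokesRegularity.NavierStokesRegularity.Theorems.ThinCascade (frame_restrict typeI_restrict)
open Summit.NavierStokesRegularity.NavierStokesRegularity.Cruxes.TypeIQuantSubcubicExp.ThinCascade (stub_uniformScaledEnergy)

/-- The time integral of the Type-I majorant across a backward cylinder of radius `ρ` below its vertex `t₁ ≤ A`:
`∫_{(t₁−ρ², t₁)} (A − t)^{-1/2} dt ≤ 2ρ` (it equals `2(√(A−t₁+ρ²) − √(A−t₁))`). -/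
theorem integral_Ioo_rpow_neg_half_le {t₁ A ρ : ℝ} (hρ : 0 < ρ) (hA : t₁ ≤ A) :
    ∫ t in Ioo (t₁ - ρ ^ 2) t₁, (A - t) ^ (-(1 / 2 : ℝ)) ≤ 2 * ρ := by
  have hρ2 : 0 < ρ ^ 2 := by positivity
  have hlt : t₁ - ρ ^ 2 ≤ t₁ := by linarith
  rw [← integral_Ioc_eq_integral_Ioo, ← intervalIntegral.integral_of_le hlt,
    intervalIntegral.integral_comp_sub_left (fun x : ℝ => x ^ (-(1 / 2 : ℝ))) A,
    integral_rpow (Or.inl (by norm_num))]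
  have e : (-(1 / 2 : ℝ) + 1) = 1 / 2 := by norm_num
  rw [e]
  set a : ℝ := A - t₁ with ha
  have ha0 : 0 ≤ a := by rw [ha]; linarith
  have e2 : A - (t₁ - ρ ^ 2) = a + ρ ^ 2 := by rw [ha]; ring
  rw [e2]
  simp only [← Real.sqrt_eq_rpow]
  have hs : Real.sqrt (a + ρ ^ 2) ≤ Real.sqrt a + ρ := by
    rw [Real.sqrt_le_left (add_nonneg (Real.sqrt_nonneg a) hρ.le)]
    have hsq : (Real.sqrt a + ρ) ^ 2 = a + 2 * Real.sqrt a * ρ + ρ ^ 2 := by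
      rw [add_sq, Real.sq_sqrt ha0]
    rw [hsq]
    nlinarith [Real.sqrt_nonneg a]
  rw [div_le_iff₀ (by norm_num : (0 : ℝ) < 1 / 2)]
  linarith

/-- **CS1 — `stub_coldCube : ColdCube` (BY NAME)**, with `C₁ := 2 max(C,0) + 1`, `C = C(M)` the constant of I1
`ThinCascade.stub_uniformScaledEnergy`. -/
theorem stub_coldCube : ColdCube := by
  intro M _hM
  obtain ⟨C, hC⟩ := stub_uniformScaledEnergy M
  refine ⟨2 * max C 0 + 1, by positivity, ?_⟩
  intro T τ u p hframe hτ hrate ε z ρ hε hρ hρz hzT hcold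
  have hρ2 : 0 < ρ ^ 2 := by positivity
  have hz0 : 0 < z.1 := lt_of_lt_of_le hρ2 hρz
  -- I1 at vertex `z.1`, radius `ρ`, centre `z.2`, for the frame restricted to `[0, z.1]`
  have hfr' := frame_restrict hframe hz0 hzT
  have hrate' := typeI_restrict hrate hzT
  have hτ' : 0 < T - z.1 + τ := by linarith
  obtain ⟨hA, -, -⟩ := hC z.1 (T - z.1 + τ) u p hfr' hτ' hrate' z.2 ρ hρ hρz
  set C' : ℝ := max C 0 with hC'
  have hC'0 : 0 ≤ C' := le_max_right _ _
  have hCC' : C ≤ C' := le_max_left _ _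
  -- pointwise on the cylinder: `‖u‖³ ≤ ε (T+τ−t)^{-1/2} ‖u‖²`
  have hpt : ∀ t ∈ Ioo (z.1 - ρ ^ 2) z.1, ∀ y ∈ ball z.2 ρ,
      ‖u t y‖ₑ ^ (3 : ℕ) ≤
        ENNReal.ofReal (ε * (T + τ - t) ^ (-(1 / 2 : ℝ))) * ENNReal.ofReal (‖u t y‖ ^ 2) := by
    intro t ht y hy
    have hs : 0 < T + τ - t := by linarith [ht.2]
    have hc := hcold (t, y) (by rw [mem_parabolicCylinder]; exact ⟨ht, hy⟩)
    have hsq : 0 < Real.sqrt (T + τ - t) := Real.sqrt_pos.2 hs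
    have hu : ‖u t y‖ ≤ ε * (T + τ - t) ^ (-(1 / 2 : ℝ)) := by
      rw [Real.rpow_neg hs.le, ← Real.sqrt_eq_rpow, ← div_eq_mul_inv, le_div_iff₀ hsq, mul_comm]
      exact hc
    have hk0 : 0 ≤ ε * (T + τ - t) ^ (-(1 / 2 : ℝ)) := mul_nonneg hε (Real.rpow_nonneg hs.le _)
    rw [← ofReal_norm, ← ENNReal.ofReal_pow (norm_nonneg _), ← ENNReal.ofReal_mul hk0]
    refine ENNReal.ofReal_le_ofReal ?_
    calc ‖u t y‖ ^ 3 = ‖u t y‖ * ‖u t y‖ ^ 2 := by ring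
      _ ≤ ε * (T + τ - t) ^ (-(1 / 2 : ℝ)) * ‖u t y‖ ^ 2 := mul_le_mul_of_nonneg_right hu (sq_nonneg _)
  -- slices: `∫_{B_ρ(z₂)} ‖u(t)‖³ ≤ ε (T+τ−t)^{-1/2} · C' ρ`
  have hslice : ∀ t ∈ Ioo (z.1 - ρ ^ 2) z.1,
      ∫⁻ y in ball z.2 ρ, ‖u t y‖ₑ ^ (3 : ℕ) ≤
        ENNReal.ofReal (ε * (T + τ - t) ^ (-(1 / 2 : ℝ)) * (C' * ρ)) := by
    intro t ht
    have hAt := hA t ⟨ht.1.le, ht.2.le⟩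
    have hs : 0 < T + τ - t := by linarith [ht.2]
    have hk0 : 0 ≤ ε * (T + τ - t) ^ (-(1 / 2 : ℝ)) := mul_nonneg hε (Real.rpow_nonneg hs.le _)
    calc ∫⁻ y in ball z.2 ρ, ‖u t y‖ₑ ^ (3 : ℕ)
        ≤ ∫⁻ y in ball z.2 ρ,
            ENNReal.ofReal (ε * (T + τ - t) ^ (-(1 / 2 : ℝ))) * ENNReal.ofReal (‖u t y‖ ^ 2) :=
          setLIntegral_mono' measurableSet_ball fun y hy => hpt t ht y hy
      _ = ENNReal.ofReal (ε * (T + τ - t) ^ (-(1 / 2 : ℝ))) *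
            ∫⁻ y in ball z.2 ρ, ENNReal.ofReal (‖u t y‖ ^ 2) :=
          lintegral_const_mul' _ _ ENNReal.ofReal_ne_top
      _ ≤ ENNReal.ofReal (ε * (T + τ - t) ^ (-(1 / 2 : ℝ))) * ENNReal.ofReal (C * ρ) :=
          mul_le_mul' le_rfl hAt
      _ ≤ ENNReal.ofReal (ε * (T + τ - t) ^ (-(1 / 2 : ℝ))) * ENNReal.ofReal (C' * ρ) :=
          mul_le_mul' le_rfl (ENNReal.ofReal_le_ofReal (mul_le_mul_of_nonneg_right hCC' hρ.le))
      _ = ENNReal.ofReal (ε * (T + τ - t) ^ (-(1 / 2 : ℝ)) * (C' * ρ)) := by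
          rw [← ENNReal.ofReal_mul hk0]
  -- the time integral of the majorant
  have hεC : 0 ≤ ε * (C' * ρ) := mul_nonneg hε (mul_nonneg hC'0 hρ.le)
  have htime : ∫⁻ t in Ioo (z.1 - ρ ^ 2) z.1, ENNReal.ofReal (ε * (T + τ - t) ^ (-(1 / 2 : ℝ)) * (C' * ρ)) ≤
      ENNReal.ofReal (ε * (C' * ρ) * (2 * ρ)) := by
    have hcont : ContinuousOn (fun t : ℝ => (T + τ - t) ^ (-(1 / 2 : ℝ))) (Icc (z.1 - ρ ^ 2) z.1) := by
      refine ContinuousOn.rpow_const (by fun_prop) fun t ht => Or.inl ?_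
      have h : 0 < T + τ - t := by linarith [ht.2]
      exact h.ne'
    have hint : IntegrableOn (fun t : ℝ => (T + τ - t) ^ (-(1 / 2 : ℝ))) (Ioo (z.1 - ρ ^ 2) z.1) :=
      (hcont.integrableOn_compact isCompact_Icc).mono_set Ioo_subset_Icc_self
    have hnn : 0 ≤ᵐ[volume.restrict (Ioo (z.1 - ρ ^ 2) z.1)]
        fun t : ℝ => (T + τ - t) ^ (-(1 / 2 : ℝ)) := by
      refine (ae_restrict_mem measurableSet_Ioo).mono fun t ht => ?_
      exact Real.rpow_nonneg (by linarith [ht.2]) _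
    have heq : ∀ t : ℝ, ENNReal.ofReal (ε * (T + τ - t) ^ (-(1 / 2 : ℝ)) * (C' * ρ)) =
        ENNReal.ofReal (ε * (C' * ρ)) * ENNReal.ofReal ((T + τ - t) ^ (-(1 / 2 : ℝ))) := by
      intro t
      rw [← ENNReal.ofReal_mul hεC]
      congr 1
      ring
    simp_rw [heq]
    rw [lintegral_const_mul' _ _ ENNReal.ofReal_ne_top, ← ofReal_integral_eq_lintegral_ofReal hint hnn,
      ← ENNReal.ofReal_mul hεC]
    refine ENNReal.ofReal_le_ofReal (mul_le_mul_of_nonneg_left ?_ hεC)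
    exact integral_Ioo_rpow_neg_half_le hρ (by linarith : z.1 ≤ T + τ)
  -- Tonelli (inequality form, no measurability needed)
  have hprod : ∫⁻ q in parabolicCylinder ρ z, ‖u q.1 q.2‖ₑ ^ (3 : ℕ) ≤
      ENNReal.ofReal (ε * (C' * ρ) * (2 * ρ)) := by
    rw [parabolicCylinder, Measure.volume_eq_prod, ← Measure.prod_restrict]
    refine (lintegral_prod_le _).trans ?_
    calc ∫⁻ t in Ioo (z.1 - ρ ^ 2) z.1, ∫⁻ y in ball z.2 ρ, ‖u t y‖ₑ ^ (3 : ℕ)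
        ≤ ∫⁻ t in Ioo (z.1 - ρ ^ 2) z.1, ENNReal.ofReal (ε * (T + τ - t) ^ (-(1 / 2 : ℝ)) * (C' * ρ)) :=
          setLIntegral_mono' measurableSet_Ioo fun t ht => hslice t ht
      _ ≤ _ := htime
  -- normalisation by `ρ⁻²`
  unfold cknC
  have hρne : ENNReal.ofReal ρ ^ 2 ≠ 0 := pow_ne_zero _ (ENNReal.ofReal_pos.2 hρ).ne'
  have hρtop : ENNReal.ofReal ρ ^ 2 ≠ ⊤ := ENNReal.pow_ne_top ENNReal.ofReal_ne_top
  calc (ENNReal.ofReal ρ ^ 2)⁻¹ * ∫⁻ q in parabolicCylinder ρ z, ‖u q.1 q.2‖ₑ ^ (3 : ℕ)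
      ≤ (ENNReal.ofReal ρ ^ 2)⁻¹ * ENNReal.ofReal (ε * (C' * ρ) * (2 * ρ)) :=
        mul_le_mul' le_rfl hprod
    _ = (ENNReal.ofReal ρ ^ 2)⁻¹ * (ENNReal.ofReal ρ ^ 2 * ENNReal.ofReal (2 * C' * ε)) := by
        rw [← ENNReal.ofReal_pow hρ.le, ← ENNReal.ofReal_mul (sq_nonneg ρ)]
        congr 1
        congr 1
        ring
    _ = ENNReal.ofReal (2 * C' * ε) := by
        rw [← mul_assoc, ENNReal.inv_mul_cancel hρne hρtop, one_mul]
    _ ≤ ENNReal.ofReal ((2 * C' + 1) * ε) := ENNReal.ofReal_le_ofReal (by nlinarith)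

end Summit.NavierStokesRegularity.NavierStokesRegularity.Cruxes.TypeIQuantSubcubicExp.ColdSmoothing

end
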